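import Summits.ValiantsHypothesis.ValiantsHypothesis.Theorems.KPlusLogSqLawTropicalSymmetricOrbitThreeFourSeventeen

/-!
# Route «KPlusLogSqLaw» — symmetric `(3,4)` orbit row, towards `TSymOrb34Le16`: position bookkeeping for the generated case analysis

HONEST FRAMING.  Helper file (seat val-sym-lift-p2 (g7), cell `pub-symmetroid`, 2026-08-27; `--supports` the `WeakLifting` item
stmt-ValiantsHypothesis-19561 as a helper, no closure claim).  Pure bookkeeping used by the generated proof of `core16` (face-free
«T^orb_sym(3,4) ≤ 16» in the orbit-carrier model): distinct rank multisets sit at distinct positions (`pos_ne`), the exponent sum of a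
position from its rank multiset (`slope_of_cs`), and the value of a position of `Fin 18` from the lists of positions below and above it
(`pos_val`, used with the parity rules P1/P2).  No census numeral; `TSymOrb34Le16` NOT asserted here; nothing on `TropicalB` / `WeakLifting`
in their windows, DoorA34 / DoorA26 (OPEN), `MatrixDescartes` (stmt-ValiantsHypothesis-18050) or VP ≠ VNP.  [bookkeeping; seat val-sym-lift-p2 g7]
-/

-- `Summit.ValiantsHypothesis.ValiantsHypothesis.…` is the tree's mandated single-conjunct layout (Sub = Summit).
set_option linter.dupNamespace false
set_option linter.unusedVariables false
set_option linter.unusedSimpArgs false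
set_option linter.unusedSectionVars false
set_option autoImplicit false

namespace Summit.ValiantsHypothesis.ValiantsHypothesis.Theorems.KPlusLogSqLaw

open Summit.ValiantsHypothesis.ValiantsHypothesis.Theorems.MatrixDescartes.Negative
open Summit.ValiantsHypothesis.ValiantsHypothesis.Theorems.LacunarySymmetroidMatrixDescartes
open Summit.ValiantsHypothesis.ValiantsHypothesis.Theorems.LacunarySymmetroidMatrixDescartes.TropicalCensus
open Finset

namespace SymmetricOrbitThreeFourSixteen

/-- positions carrying different rank multisets are different. -/
theorem pos_ne {n : ℕ} (r : Fin n → Equiv.Perm (Fin 3) × (Fin 3 → Fin 4)) (a b : Fin n) {u v : Sym (Fin 4) 3}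
    (ha : TropicalCensus.classSym (r a) = u) (hb : TropicalCensus.classSym (r b) = v) (huv : u ≠ v) : a ≠ b := by
  rintro rfl
  exact huv (ha.symm.trans hb)

/-- the exponent sum of a position, read off its rank multiset. [slope_eq_of_classSym] -/
theorem slope_of_cs (g : Fin 4 → ℕ) (p : Equiv.Perm (Fin 3) × (Fin 3 → Fin 4)) (a b c : Fin 4)
    (h : TropicalCensus.classSym p = TropicalCensus.classSym ((1 : Equiv.Perm (Fin 3)), (![a, b, c] : Fin 3 → Fin 4))) :
    TropicalCensus.slope g p = (g a : ℤ) + g b + g c := by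
  rw [slope_eq_of_classSym, h, ← slope_eq_of_classSym]
  simp [TropicalCensus.slope, Fin.sum_univ_three, add_assoc]

/-- the value of a position of `Fin 18` from a list of positions below it and a list above it, of total length `17`, each without
repeated rank multisets. [Fin.card_Iio / Fin.card_Ioi] -/
theorem pos_val (r : Fin 18 → Equiv.Perm (Fin 3) × (Fin 3 → Fin 4)) (a : Fin 18) (lo hi : List (Fin 18))
    (hlo : ∀ x ∈ lo, x < a) (hhi : ∀ x ∈ hi, a < x)
    (nlo : (lo.map fun x => TropicalCensus.classSym (r x)).Nodup) (nhi : (hi.map fun x => TropicalCensus.classSym (r x)).Nodup)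
    (hlen : lo.length + hi.length = 17) : a.val = lo.length := by
  have dlo : lo.Nodup := nlo.of_map _
  have dhi : hi.Nodup := nhi.of_map _
  have h1 : lo.toFinset ⊆ Finset.Iio a := fun x hx => Finset.mem_Iio.mpr (hlo x (List.mem_toFinset.mp hx))
  have h2 : hi.toFinset ⊆ Finset.Ioi a := fun x hx => Finset.mem_Ioi.mpr (hhi x (List.mem_toFinset.mp hx))
  have c1 := Finset.card_le_card h1
  have c2 := Finset.card_le_card h2
  rw [List.toFinset_card_of_nodup dlo, Fin.card_Iio] at c1
  rw [List.toFinset_card_of_nodup dhi, Fin.card_Ioi] at c2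
  omega

/-! ## Uniform one-line forms of the chain rules (used by the generated case analysis) -/

section Rules

variable (r : Fin 18 → Equiv.Perm (Fin 3) × (Fin 3 → Fin 4)) (g : Fin 4 → ℕ)

/-- order of two positions from the order of their exponent sums. [hS contraposed] -/
theorem ord_cs (hS : ∀ a b : Fin 18, a < b → TropicalCensus.slope g (r a) < TropicalCensus.slope g (r b))
    (a b : Fin 18) {a1 a2 a3 b1 b2 b3 : Fin 4}
    (ha : TropicalCensus.classSym (r a) = TropicalCensus.classSym ((1 : Equiv.Perm (Fin 3)), (![a1, a2, a3] : Fin 3 → Fin 4)))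
    (hb : TropicalCensus.classSym (r b) = TropicalCensus.classSym ((1 : Equiv.Perm (Fin 3)), (![b1, b2, b3] : Fin 3 → Fin 4)))
    (hne : TropicalCensus.classSym ((1 : Equiv.Perm (Fin 3)), (![a1, a2, a3] : Fin 3 → Fin 4)) ≠
      TropicalCensus.classSym ((1 : Equiv.Perm (Fin 3)), (![b1, b2, b3] : Fin 3 → Fin 4)))
    (hle : (g a1 : ℤ) + g a2 + g a3 ≤ (g b1 : ℤ) + g b2 + g b3) : a < b := by
  rcases lt_or_gt_of_ne (pos_ne r a b ha hb hne) with o | o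
  · exact o
  · have h := hS b a o
    rw [slope_of_cs g (r a) a1 a2 a3 ha, slope_of_cs g (r b) b1 b2 b3 hb] at h
    omega

/-- exponent sums along the chain, numerically. [hS] -/
theorem S_cs (hS : ∀ a b : Fin 18, a < b → TropicalCensus.slope g (r a) < TropicalCensus.slope g (r b))
    (a b : Fin 18) (o : a < b) {a1 a2 a3 b1 b2 b3 : Fin 4}
    (ha : TropicalCensus.classSym (r a) = TropicalCensus.classSym ((1 : Equiv.Perm (Fin 3)), (![a1, a2, a3] : Fin 3 → Fin 4)))
    (hb : TropicalCensus.classSym (r b) = TropicalCensus.classSym ((1 : Equiv.Perm (Fin 3)), (![b1, b2, b3] : Fin 3 → Fin 4))) :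
    (g a1 : ℤ) + g a2 + g a3 < (g b1 : ℤ) + g b2 + g b3 := by
  have h := hS a b o
  rwa [slope_of_cs g (r a) a1 a2 a3 ha, slope_of_cs g (r b) b1 b2 b3 hb] at h

/-- R3w against a normalised pair carrier, all three pairs at once. [hR3] -/
theorem useR3 (hR3 : ∀ a b : Fin 18, a < b → (r a).1 = 1 → ∀ i j k : Fin 3, i ≠ j → k ≠ i → k ≠ j →
      (r b).1 i = j → (r b).1 j = k → (r b).1 k = i → g ((r a).2 i) + g ((r a).2 j) < 2 * g ((r b).2 i))
    (a b : Fin 18) (o : a < b) (sa : (r a).1 = 1) (sb : (r b).1 = finRotate 3) :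
    g ((r a).2 0) + g ((r a).2 1) < 2 * g ((r b).2 0) ∧ g ((r a).2 1) + g ((r a).2 2) < 2 * g ((r b).2 1) ∧
      g ((r a).2 2) + g ((r a).2 0) < 2 * g ((r b).2 2) :=
  ⟨hR3 a b o sa 0 1 2 (by decide) (by decide) (by decide) (by rw [sb]; decide) (by rw [sb]; decide) (by rw [sb]; decide),
   hR3 a b o sa 1 2 0 (by decide) (by decide) (by decide) (by rw [sb]; decide) (by rw [sb]; decide) (by rw [sb]; decide),
   hR3 a b o sa 2 0 1 (by decide) (by decide) (by decide) (by rw [sb]; decide) (by rw [sb]; decide) (by rw [sb]; decide)⟩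

/-- R3′w against a normalised pair carrier, all three pairs at once. [hR3'] -/
theorem useR3p (hR3' : ∀ a b : Fin 18, a < b → (r b).1 = 1 → ∀ i j k : Fin 3, i ≠ j → k ≠ i → k ≠ j →
      (r a).1 i = j → (r a).1 j = k → (r a).1 k = i → 2 * g ((r a).2 i) < g ((r b).2 i) + g ((r b).2 j))
    (a b : Fin 18) (o : a < b) (sa : (r a).1 = finRotate 3) (sb : (r b).1 = 1) :
    2 * g ((r a).2 0) < g ((r b).2 0) + g ((r b).2 1) ∧ 2 * g ((r a).2 1) < g ((r b).2 1) + g ((r b).2 2) ∧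
      2 * g ((r a).2 2) < g ((r b).2 2) + g ((r b).2 0) :=
  ⟨hR3' a b o sb 0 1 2 (by decide) (by decide) (by decide) (by rw [sa]; decide) (by rw [sa]; decide) (by rw [sa]; decide),
   hR3' a b o sb 1 2 0 (by decide) (by decide) (by decide) (by rw [sa]; decide) (by rw [sa]; decide) (by rw [sa]; decide),
   hR3' a b o sb 2 0 1 (by decide) (by decide) (by decide) (by rw [sa]; decide) (by rw [sa]; decide) (by rw [sa]; decide)⟩

/-- R2w, transposition `(0 1)` before a normalised pair carrier. [hR2 with `(i,j,k) = (0,1,2)`] -/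
theorem useR2_01 (hR2 : ∀ a b : Fin 18, a < b → ∀ i j k : Fin 3, i ≠ j → k ≠ i → k ≠ j → (r a).1 = Equiv.swap i j →
      (r a).2 i = (r a).2 j → (r b).1 i = j → (r b).1 j = k → (r b).1 k = i → g ((r a).2 k) + g ((r a).2 i) < g ((r b).2 j) + g ((r b).2 k))
    (a b : Fin 18) (o : a < b) (sa : (r a).1 = Equiv.swap 0 1) (hcc : (r a).2 0 = (r a).2 1) (sb : (r b).1 = finRotate 3) :
    g ((r a).2 2) + g ((r a).2 0) < g ((r b).2 1) + g ((r b).2 2) :=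
  hR2 a b o 0 1 2 (by decide) (by decide) (by decide) sa hcc (by rw [sb]; decide) (by rw [sb]; decide) (by rw [sb]; decide)

/-- R2w, transposition `(1 2)` before a normalised pair carrier. [hR2 with `(i,j,k) = (1,2,0)`] -/
theorem useR2_12 (hR2 : ∀ a b : Fin 18, a < b → ∀ i j k : Fin 3, i ≠ j → k ≠ i → k ≠ j → (r a).1 = Equiv.swap i j →
      (r a).2 i = (r a).2 j → (r b).1 i = j → (r b).1 j = k → (r b).1 k = i → g ((r a).2 k) + g ((r a).2 i) < g ((r b).2 j) + g ((r b).2 k))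
    (a b : Fin 18) (o : a < b) (sa : (r a).1 = Equiv.swap 1 2) (hcc : (r a).2 1 = (r a).2 2) (sb : (r b).1 = finRotate 3) :
    g ((r a).2 0) + g ((r a).2 1) < g ((r b).2 2) + g ((r b).2 0) :=
  hR2 a b o 1 2 0 (by decide) (by decide) (by decide) sa hcc (by rw [sb]; decide) (by rw [sb]; decide) (by rw [sb]; decide)

/-- R2w, transposition `(0 2)` before a normalised pair carrier. [hR2 with `(i,j,k) = (2,0,1)`] -/
theorem useR2_02 (hR2 : ∀ a b : Fin 18, a < b → ∀ i j k : Fin 3, i ≠ j → k ≠ i → k ≠ j → (r a).1 = Equiv.swap i j →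
      (r a).2 i = (r a).2 j → (r b).1 i = j → (r b).1 j = k → (r b).1 k = i → g ((r a).2 k) + g ((r a).2 i) < g ((r b).2 j) + g ((r b).2 k))
    (a b : Fin 18) (o : a < b) (sa : (r a).1 = Equiv.swap 0 2) (hcc : (r a).2 0 = (r a).2 2) (sb : (r b).1 = finRotate 3) :
    g ((r a).2 1) + g ((r a).2 2) < g ((r b).2 0) + g ((r b).2 1) :=
  hR2 a b o 2 0 1 (by decide) (by decide) (by decide) (by rw [sa, Equiv.swap_comm]) hcc.symm
    (by rw [sb]; decide) (by rw [sb]; decide) (by rw [sb]; decide)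

/-- R2′w, normalised pair carrier before the transposition `(0 1)`. [hR2' with `(i,j,k) = (0,1,2)`] -/
theorem useR2p_01 (hR2' : ∀ a b : Fin 18, a < b → ∀ i j k : Fin 3, i ≠ j → k ≠ i → k ≠ j → (r a).1 i = j → (r a).1 j = k →
      (r a).1 k = i → (r b).1 = Equiv.swap i j → (r b).2 i = (r b).2 j → g ((r a).2 j) + g ((r a).2 k) < g ((r b).2 k) + g ((r b).2 i))
    (a b : Fin 18) (o : a < b) (sa : (r a).1 = finRotate 3) (sb : (r b).1 = Equiv.swap 0 1) (hcc : (r b).2 0 = (r b).2 1) :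
    g ((r a).2 1) + g ((r a).2 2) < g ((r b).2 2) + g ((r b).2 0) :=
  hR2' a b o 0 1 2 (by decide) (by decide) (by decide) (by rw [sa]; decide) (by rw [sa]; decide) (by rw [sa]; decide) sb hcc

/-- R2′w, normalised pair carrier before the transposition `(1 2)`. [hR2' with `(i,j,k) = (1,2,0)`] -/
theorem useR2p_12 (hR2' : ∀ a b : Fin 18, a < b → ∀ i j k : Fin 3, i ≠ j → k ≠ i → k ≠ j → (r a).1 i = j → (r a).1 j = k →
      (r a).1 k = i → (r b).1 = Equiv.swap i j → (r b).2 i = (r b).2 j → g ((r a).2 j) + g ((r a).2 k) < g ((r b).2 k) + g ((r b).2 i))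
    (a b : Fin 18) (o : a < b) (sa : (r a).1 = finRotate 3) (sb : (r b).1 = Equiv.swap 1 2) (hcc : (r b).2 1 = (r b).2 2) :
    g ((r a).2 2) + g ((r a).2 0) < g ((r b).2 0) + g ((r b).2 1) :=
  hR2' a b o 1 2 0 (by decide) (by decide) (by decide) (by rw [sa]; decide) (by rw [sa]; decide) (by rw [sa]; decide) sb hcc

/-- R2′w, normalised pair carrier before the transposition `(0 2)`. [hR2' with `(i,j,k) = (2,0,1)`] -/
theorem useR2p_02 (hR2' : ∀ a b : Fin 18, a < b → ∀ i j k : Fin 3, i ≠ j → k ≠ i → k ≠ j → (r a).1 i = j → (r a).1 j = k →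
      (r a).1 k = i → (r b).1 = Equiv.swap i j → (r b).2 i = (r b).2 j → g ((r a).2 j) + g ((r a).2 k) < g ((r b).2 k) + g ((r b).2 i))
    (a b : Fin 18) (o : a < b) (sa : (r a).1 = finRotate 3) (sb : (r b).1 = Equiv.swap 0 2) (hcc : (r b).2 0 = (r b).2 2) :
    g ((r a).2 0) + g ((r a).2 1) < g ((r b).2 1) + g ((r b).2 2) :=
  hR2' a b o 2 0 1 (by decide) (by decide) (by decide) (by rw [sa]; decide) (by rw [sa]; decide) (by rw [sa]; decide)
    (by rw [sb, Equiv.swap_comm]) hcc.symm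

end Rules

end SymmetricOrbitThreeFourSixteen

end Summit.ValiantsHypothesis.ValiantsHypothesis.Theorems.KPlusLogSqLaw
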